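import Mathlib
import Summits.KontsevichZagierPeriods.Zeta5Search.Denom.TwoTaleP15Forms
import HarnessLib

/-!
# ζ(5) search — transfer of a creative-telescoping identity from the integrals to the coefficients (cell `pub-zeta5`, seat ct-1 g9)

HONEST FRAMING: systematic search; no irrationality claim unless kernel-certified. Nothing in this file is an irrationality result,
a worthiness exponent or a denominator statement; it is the ABSTRACT inference chain of `HOME/ct-1/g3/CT-ROUTES-g3.md` §1
(the "Corollary" step of ct-1 g7/g8/g9's THEOREMS B/C), kernel-checked once and for all, with every analytic input left as a
HYPOTHESIS:

* `coeff_transfer`: if real numbers `I n = Q n · α − 4 · P̂ n · ζ₂ − 2 · P n` (`Q, P̂, P` rational — the shape of Brown–Zudilin's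
  decomposition (4), `α = 2ζ(5) + 4ζ(2)ζ(3)`, `ζ₂ = ζ(2)`) satisfy a linear recurrence `Σ_j c_j(n) I(n+j) = 0` with RATIONAL
  coefficients, and the same recurrence kills `Q`, and `ζ₂` is irrational, then the recurrence kills `P̂` and `P` separately.
  (In print: BZ22 p. 13 «which is then automatically valid for their coefficients Q(an), P(an), P̂(an)»; the cell's route avoids the
  expected-but-unproved ℚ-linear independence of `1, ζ(2), ζ(5)+2ζ(2)ζ(3)` by using `L·Q = 0` — on the rays this comes from BZ22 (17) and
  the kernel theorem `WedgeDictionary.wedgeDictionary_Q` — and only `ζ(2) ∉ ℚ`, a tree theorem.)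
* `eq_of_recurrence`: two solutions of one order-`d+1`… precisely: of `Σ_{j ≤ d} c_j(n) x(n+j) = 0` whose LEADING coefficient
  `c_d(n)` never vanishes and which agree at `n < d` agree everywhere.
* `dictionary_identification`: the two combined — the all-`n` identification of two coefficient sequences (`P̂, P` "true" vs
  `P̂′, P′` "dictionary") from: the CT identity for the integrals, `L·Q = 0`, `L·P̂′ = L·P′ = 0`, `ζ₂ ∉ ℚ`, `c_d ≠ 0`, and `d` initial rows.

What is NOT here (and stays at its own tier): the CT identities themselves (THEOREM B: `L_cell·I(a·n) = 0` on the flag ray, exact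
computer proof ×2; THEOREM C: `L_cell_rec·I(a_rec·n) = 0` on BZ's record ray, ×2 with ct-1 g9), g54's `L·dict = 0`, and the exact rows —
they enter only as hypotheses of `dictionary_identification`. Class 60;10,12,16,18,22,24,28 words = the coordinator-fixed sentence only.
-/

namespace Summit.KontsevichZagierPeriods.Zeta5Search.CTTransfer

open Finset

/-- A rational combination `a·x + b = 0` of an irrational `x` has `a = 0` and `b = 0`. -/
theorem rat_coeff_eq_zero_of_irrational {x : ℝ} (hx : Irrational x) {a b : ℚ}
    (h : (a : ℝ) * x + b = 0) : a = 0 ∧ b = 0 := by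
  by_cases ha : a = 0
  · subst ha
    simp only [Rat.cast_zero, zero_mul, zero_add, Rat.cast_eq_zero] at h
    exact ⟨rfl, h⟩
  · exfalso
    have hx' : x = ((-b / a : ℚ) : ℝ) := by
      have ha' : (a : ℝ) ≠ 0 := by exact_mod_cast ha
      push_cast
      field_simp
      linarith
    exact hx ⟨-b / a, hx'.symm⟩

/-- **Transfer of a rational-coefficient recurrence from the linear forms to the coefficients.**
If `I n = Q n · α − 4 · Ph n · ζ₂ − 2 · P n` with `Q, Ph, P` rational, `Σ_j c j n · I (n+j) = 0` and `Σ_j c j n · Q (n+j) = 0`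
for all `n` (rational `c`), and `ζ₂` is irrational, then `Σ_j c j n · Ph (n+j) = 0` and `Σ_j c j n · P (n+j) = 0` for all `n`. -/
theorem coeff_transfer {d : ℕ} (c : Fin (d + 1) → ℕ → ℚ) {α ζ₂ : ℝ} (hζ : Irrational ζ₂)
    (I : ℕ → ℝ) (Q Ph P : ℕ → ℚ)
    (hI : ∀ n, I n = (Q n : ℝ) * α - 4 * (Ph n : ℝ) * ζ₂ - 2 * (P n : ℝ))
    (hLI : ∀ n, ∑ j : Fin (d + 1), (c j n : ℝ) * I (n + j) = 0)
    (hLQ : ∀ n, ∑ j : Fin (d + 1), c j n * Q (n + j) = 0) :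
    (∀ n, ∑ j : Fin (d + 1), c j n * Ph (n + j) = 0) ∧ (∀ n, ∑ j : Fin (d + 1), c j n * P (n + j) = 0) := by
  have key : ∀ n, (∑ j : Fin (d + 1), c j n * Ph (n + j)) = 0 ∧ (∑ j : Fin (d + 1), c j n * P (n + j)) = 0 := by
    intro n
    have h1 := hLI n
    simp only [hI] at h1
    have hQ : (∑ j : Fin (d + 1), (c j n : ℝ) * (Q (n + j) : ℝ)) = 0 := by
      have := congrArg (fun q : ℚ => (q : ℝ)) (hLQ n)
      simpa [Rat.cast_sum, Rat.cast_mul] using this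
    -- the combination equals  α·(L Q) − 4 ζ₂ (L Ph) − 2 (L P)
    have h2 : ((-4 * ∑ j : Fin (d + 1), c j n * Ph (n + j) : ℚ) : ℝ) * ζ₂
        + ((-2 * ∑ j : Fin (d + 1), c j n * P (n + j) : ℚ) : ℝ) = 0 := by
      have e : ∑ j : Fin (d + 1), (c j n : ℝ) * ((Q (n + j) : ℝ) * α - 4 * (Ph (n + j) : ℝ) * ζ₂ - 2 * (P (n + j) : ℝ))
          = α * ∑ j : Fin (d + 1), (c j n : ℝ) * (Q (n + j) : ℝ)
            + ((-4 * ∑ j : Fin (d + 1), c j n * Ph (n + j) : ℚ) : ℝ) * ζ₂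
            + ((-2 * ∑ j : Fin (d + 1), c j n * P (n + j) : ℚ) : ℝ) := by
        push_cast
        simp only [mul_sum, sum_mul, ← sum_add_distrib]
        refine sum_congr rfl fun j _ => by ring
      rw [e, hQ, mul_zero, zero_add] at h1
      exact h1
    have h3 := rat_coeff_eq_zero_of_irrational hζ h2
    constructor
    · have := h3.1; simpa using this
    · have := h3.2; simpa using this
  exact ⟨fun n => (key n).1, fun n => (key n).2⟩

/-- **Uniqueness for a linear recurrence with non-vanishing leading coefficient.** Two solutions of
`Σ_{j ≤ d} c j n · x (n + j) = 0` (over a field) with `c d n ≠ 0` for all `n`, agreeing at `n < d`, agree everywhere. -/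
theorem eq_of_recurrence {K : Type*} [Field K] {d : ℕ} (c : Fin (d + 1) → ℕ → K)
    (hc : ∀ n, c (Fin.last d) n ≠ 0) (u v : ℕ → K)
    (hu : ∀ n, ∑ j : Fin (d + 1), c j n * u (n + j) = 0)
    (hv : ∀ n, ∑ j : Fin (d + 1), c j n * v (n + j) = 0)
    (h0 : ∀ n < d, u n = v n) : u = v := by
  funext m
  induction m using Nat.strong_induction_on with
  | _ m ih =>
    by_cases hm : m < d
    · exact h0 m hm
    · -- m = n + d with the relation at n
      obtain ⟨n, rfl⟩ : ∃ n, m = n + d := ⟨m - d, by omega⟩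
      have hu' := hu n
      have hv' := hv n
      rw [Fin.sum_univ_castSucc] at hu' hv'
      simp only [Fin.val_castSucc, Fin.val_last] at hu' hv'
      have hs : ∑ j : Fin d, c (Fin.castSucc j) n * u (n + j) = ∑ j : Fin d, c (Fin.castSucc j) n * v (n + j) := by
        refine sum_congr rfl fun j _ => ?_
        rw [ih (n + j) (by omega)]
      have : c (Fin.last d) n * u (n + d) = c (Fin.last d) n * v (n + d) := by
        rw [hs] at hu'; linear_combination hu' - hv'
      exact mul_left_cancel₀ (hc n) this

/-- **The all-`n` identification (CT-ROUTES-g3 §1, abstract form).** Inputs, all as hypotheses: the decomposition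
`I n = Q n·α − 4·Ph n·ζ₂ − 2·P n` ("true" coefficients, BZ22 (4)); a rational-coefficient recurrence killing the integrals `I`
(a creative-telescoping identity — THEOREM B / C of the cell, exact computer proofs, NOT kernel) and killing `Q`, `Ph'`, `P'`
(the "dictionary" triple — g54's exact derivation, NOT kernel); `ζ₂` irrational (kernel: `Denom.TwoTaleP15Forms.irrational_zetaValue_two`);
non-vanishing leading coefficient; and agreement of `(Ph, P)` with `(Ph', P')` at the first `d` indices (the exact rows). Output:
`Ph = Ph'` and `P = P'`. -/
theorem dictionary_identification {d : ℕ} (c : Fin (d + 1) → ℕ → ℚ) (hc : ∀ n, c (Fin.last d) n ≠ 0)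
    {α ζ₂ : ℝ} (hζ : Irrational ζ₂) (I : ℕ → ℝ) (Q Ph P Ph' P' : ℕ → ℚ)
    (hI : ∀ n, I n = (Q n : ℝ) * α - 4 * (Ph n : ℝ) * ζ₂ - 2 * (P n : ℝ))
    (hLI : ∀ n, ∑ j : Fin (d + 1), (c j n : ℝ) * I (n + j) = 0)
    (hLQ : ∀ n, ∑ j : Fin (d + 1), c j n * Q (n + j) = 0)
    (hLPh' : ∀ n, ∑ j : Fin (d + 1), c j n * Ph' (n + j) = 0)
    (hLP' : ∀ n, ∑ j : Fin (d + 1), c j n * P' (n + j) = 0)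
    (h0 : ∀ n < d, Ph n = Ph' n ∧ P n = P' n) : Ph = Ph' ∧ P = P' := by
  obtain ⟨hPh, hP⟩ := coeff_transfer c hζ I Q Ph P hI hLI hLQ
  exact ⟨eq_of_recurrence c hc Ph Ph' hPh hLPh' fun n hn => (h0 n hn).1,
    eq_of_recurrence c hc P P' hP hLP' fun n hn => (h0 n hn).2⟩

/-! ### The instance `ζ₂ = ζ(2)`: the one analytic input the kernel needs is already a tree theorem
(`Denom.TwoTaleP15Forms.irrational_zetaValue_two`, from Mathlib's `hasSum_zeta_two` and the tree's proved Lindemann theorem) -/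

open Literature.NumberTheory.Transcendental (zetaValue) in
/-- **All-`n` identification with `ζ₂ = ζ(2)`** (unconditional in the irrationality input; the CT identity for the integrals,
`L·Q = 0`, `L·(dictionary) = 0`, the leading coefficient and the initial rows remain HYPOTHESES — exact computer proofs / exact rows
in the cell, not kernel objects). -/
theorem dictionary_identification_zeta_two {d : ℕ} (c : Fin (d + 1) → ℕ → ℚ) (hc : ∀ n, c (Fin.last d) n ≠ 0)
    {α : ℝ} (I : ℕ → ℝ) (Q Ph P Ph' P' : ℕ → ℚ)
    (hI : ∀ n, I n = (Q n : ℝ) * α - 4 * (Ph n : ℝ) * zetaValue 2 - 2 * (P n : ℝ))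
    (hLI : ∀ n, ∑ j : Fin (d + 1), (c j n : ℝ) * I (n + j) = 0)
    (hLQ : ∀ n, ∑ j : Fin (d + 1), c j n * Q (n + j) = 0)
    (hLPh' : ∀ n, ∑ j : Fin (d + 1), c j n * Ph' (n + j) = 0)
    (hLP' : ∀ n, ∑ j : Fin (d + 1), c j n * P' (n + j) = 0)
    (h0 : ∀ n < d, Ph n = Ph' n ∧ P n = P' n) : Ph = Ph' ∧ P = P' :=
  dictionary_identification c hc Denom.TwoTaleP15Forms.irrational_zetaValue_two I Q Ph P Ph' P' hI hLI hLQ hLPh' hLP' h0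

/-! ### Threshold versions (ct-1 g10): identities valid from an index `n₀` on

The cell's creative-telescoping identities hold from a threshold (THEOREM B on the flag ray: integer `n ≥ 2` by the determinant
route; the leading coefficient is root-free on `n ≥ 1`). The lemmas below are the `n ≥ n₀` forms of `coeff_transfer`,
`eq_of_recurrence` and `dictionary_identification`, obtained by shifting the index; nothing else changes (every analytic input
stays a HYPOTHESIS). -/

/-- `coeff_transfer` from a threshold: if the decomposition, the recurrence for `I` and the recurrence for `Q` hold for all
`n ≥ n₀`, then the recurrence kills `Ph` and `P` for all `n ≥ n₀`. -/
theorem coeff_transfer_from {d : ℕ} (c : Fin (d + 1) → ℕ → ℚ) (n₀ : ℕ) {α ζ₂ : ℝ} (hζ : Irrational ζ₂)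
    (I : ℕ → ℝ) (Q Ph P : ℕ → ℚ)
    (hI : ∀ n, n₀ ≤ n → I n = (Q n : ℝ) * α - 4 * (Ph n : ℝ) * ζ₂ - 2 * (P n : ℝ))
    (hLI : ∀ n, n₀ ≤ n → ∑ j : Fin (d + 1), (c j n : ℝ) * I (n + j) = 0)
    (hLQ : ∀ n, n₀ ≤ n → ∑ j : Fin (d + 1), c j n * Q (n + j) = 0) :
    (∀ n, n₀ ≤ n → ∑ j : Fin (d + 1), c j n * Ph (n + j) = 0)
      ∧ (∀ n, n₀ ≤ n → ∑ j : Fin (d + 1), c j n * P (n + j) = 0) := by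
  -- shift everything by `n₀` and apply `coeff_transfer`
  have h := coeff_transfer (fun j n => c j (n + n₀)) hζ (fun n => I (n + n₀)) (fun n => Q (n + n₀))
    (fun n => Ph (n + n₀)) (fun n => P (n + n₀)) (fun n => hI (n + n₀) (by omega))
    (fun n => by
      have := hLI (n + n₀) (by omega)
      simpa [add_right_comm] using this)
    (fun n => by
      have := hLQ (n + n₀) (by omega)
      simpa [add_right_comm] using this)
  refine ⟨fun n hn => ?_, fun n hn => ?_⟩
  · obtain ⟨m, rfl⟩ : ∃ m, n = m + n₀ := ⟨n - n₀, by omega⟩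
    simpa [add_right_comm] using h.1 m
  · obtain ⟨m, rfl⟩ : ∃ m, n = m + n₀ := ⟨n - n₀, by omega⟩
    simpa [add_right_comm] using h.2 m

/-- `eq_of_recurrence` from a threshold: two solutions of `Σ_{j ≤ d} c j n · x (n + j) = 0` for `n ≥ n₀`, whose leading
coefficient does not vanish for `n ≥ n₀`, and which agree at `n₀ ≤ n < n₀ + d`, agree for all `n ≥ n₀`. -/
theorem eq_of_recurrence_from {K : Type*} [Field K] {d : ℕ} (c : Fin (d + 1) → ℕ → K) (n₀ : ℕ)
    (hc : ∀ n, n₀ ≤ n → c (Fin.last d) n ≠ 0) (u v : ℕ → K)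
    (hu : ∀ n, n₀ ≤ n → ∑ j : Fin (d + 1), c j n * u (n + j) = 0)
    (hv : ∀ n, n₀ ≤ n → ∑ j : Fin (d + 1), c j n * v (n + j) = 0)
    (h0 : ∀ n, n₀ ≤ n → n < n₀ + d → u n = v n) : ∀ n, n₀ ≤ n → u n = v n := by
  have h := eq_of_recurrence (fun j n => c j (n + n₀)) (fun n => hc (n + n₀) (by omega)) (fun n => u (n + n₀))
    (fun n => v (n + n₀))
    (fun n => by
      have := hu (n + n₀) (by omega)
      simpa [add_right_comm] using this)
    (fun n => by
      have := hv (n + n₀) (by omega)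
      simpa [add_right_comm] using this)
    (fun n hn => h0 (n + n₀) (by omega) (by omega))
  intro n hn
  obtain ⟨m, rfl⟩ : ∃ m, n = m + n₀ := ⟨n - n₀, by omega⟩
  exact congrFun h m

/-- **The all-`n ≥ n₀` identification** (`dictionary_identification` from a threshold): the CT identity for the integrals, the
recurrence for `Q`, `Ph'`, `P'` and the non-vanishing of the leading coefficient are assumed only for `n ≥ n₀`, together with
agreement on the window `n₀ ≤ n < n₀ + d`; conclusion: `Ph n = Ph' n` and `P n = P' n` for every `n ≥ n₀`. -/
theorem dictionary_identification_from {d : ℕ} (c : Fin (d + 1) → ℕ → ℚ) (n₀ : ℕ)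
    (hc : ∀ n, n₀ ≤ n → c (Fin.last d) n ≠ 0) {α ζ₂ : ℝ} (hζ : Irrational ζ₂) (I : ℕ → ℝ) (Q Ph P Ph' P' : ℕ → ℚ)
    (hI : ∀ n, n₀ ≤ n → I n = (Q n : ℝ) * α - 4 * (Ph n : ℝ) * ζ₂ - 2 * (P n : ℝ))
    (hLI : ∀ n, n₀ ≤ n → ∑ j : Fin (d + 1), (c j n : ℝ) * I (n + j) = 0)
    (hLQ : ∀ n, n₀ ≤ n → ∑ j : Fin (d + 1), c j n * Q (n + j) = 0)
    (hLPh' : ∀ n, n₀ ≤ n → ∑ j : Fin (d + 1), c j n * Ph' (n + j) = 0)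
    (hLP' : ∀ n, n₀ ≤ n → ∑ j : Fin (d + 1), c j n * P' (n + j) = 0)
    (h0 : ∀ n, n₀ ≤ n → n < n₀ + d → Ph n = Ph' n ∧ P n = P' n) :
    ∀ n, n₀ ≤ n → Ph n = Ph' n ∧ P n = P' n := by
  obtain ⟨hPh, hP⟩ := coeff_transfer_from c n₀ hζ I Q Ph P hI hLI hLQ
  intro n hn
  exact ⟨eq_of_recurrence_from c n₀ hc Ph Ph' hPh hLPh' (fun m hm hm' => (h0 m hm hm').1) n hn,
    eq_of_recurrence_from c n₀ hc P P' hP hLP' (fun m hm hm' => (h0 m hm hm').2) n hn⟩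

open Literature.NumberTheory.Transcendental (zetaValue) in
/-- **The all-`n ≥ n₀` identification with `ζ₂ = ζ(2)`** (irrationality discharged from the tree; everything else a hypothesis). -/
theorem dictionary_identification_zeta_two_from {d : ℕ} (c : Fin (d + 1) → ℕ → ℚ) (n₀ : ℕ)
    (hc : ∀ n, n₀ ≤ n → c (Fin.last d) n ≠ 0) {α : ℝ} (I : ℕ → ℝ) (Q Ph P Ph' P' : ℕ → ℚ)
    (hI : ∀ n, n₀ ≤ n → I n = (Q n : ℝ) * α - 4 * (Ph n : ℝ) * zetaValue 2 - 2 * (P n : ℝ))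
    (hLI : ∀ n, n₀ ≤ n → ∑ j : Fin (d + 1), (c j n : ℝ) * I (n + j) = 0)
    (hLQ : ∀ n, n₀ ≤ n → ∑ j : Fin (d + 1), c j n * Q (n + j) = 0)
    (hLPh' : ∀ n, n₀ ≤ n → ∑ j : Fin (d + 1), c j n * Ph' (n + j) = 0)
    (hLP' : ∀ n, n₀ ≤ n → ∑ j : Fin (d + 1), c j n * P' (n + j) = 0)
    (h0 : ∀ n, n₀ ≤ n → n < n₀ + d → Ph n = Ph' n ∧ P n = P' n) :
    ∀ n, n₀ ≤ n → Ph n = Ph' n ∧ P n = P' n :=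
  dictionary_identification_from c n₀ hc Denom.TwoTaleP15Forms.irrational_zetaValue_two I Q Ph P Ph' P' hI hLI hLQ hLPh'
    hLP' h0

end Summit.KontsevichZagierPeriods.Zeta5Search.CTTransfer
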